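import Summits.QuantumFields.YangMills.Theorems.BalabanLadderInfVolCeilings
import Summits.QuantumFields.YangMills.Theorems.LangevinControlUVOSLegsAtWeakCouplingCStubDensity
import HarnessLib

/-!
# Route `InfiniteVolumeContinuum`, support `IVEuclideanInvariance` (stmt-QuantumFields-19933): stub `stub_ivDensity` (W2)
# — bounded densities off the diagonal for the infinite-volume-first continuum data

Lead seat `ym-infvol-p1` (R136 (i)); registered stub W2 of the skeleton `IVEuclideanInvariance_proof` (evidence #1 on
19933).  HONEST FRAMING: existence half only, conditional on Track A's `BalabanLadder.UV`; the ceilings `MomentBounds6` are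
a HYPOTHESIS; nothing about Yang–Mills is asserted; not a gap, not Clay.

`stub_ivDensity`: for every tuple `(β, μ, S₁, T)` satisfying the route's DATA clause (`β_k → ∞`, `μ_k ∈ oddTorusLimitPoints`,
conventions `S₁ 0 = ev`, `S₁ 1 = 0`, `S₁ n = Σ_{q valid} T n q`, convergence on `⁰𝒮` of the plaquette-CENTRE-smeared
infinite-volume plane-string series) in a positive unit `a → 0` with `MomentBounds6 G r a`, the one-field family has
bounded densities off the big diagonal (`Sketch.OffDiagDensity S₁`).  The infinite-volume twin of the spine's
`Sketch.stub_density` — and simpler: no wrap-around.  For a compactly supported `F` supported at pairwise distances `≥ δ`,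
a lattice string `x` contributes to `Σ'ₓ W_{μ_k}(q,x) F(a_k x + a_k o_q)` only if its sites are pairwise
`≥ (δ − 2a_k)/(2a_k)` apart in the sup norm (the centre offsets have norm `≤ a_k`), so the volume-free collar output
(`MomentBounds6TL`, `momentBounds6TL_of_momentBounds6`) at the collar radius of the spine's `exists_collar_radius` gives
`|W| ≤ (C κ⁴)ⁿ a_k^{4n}`, `κ = 48/δ + 2/ℓ₄ + 24`; the resulting Riemann sums with the moving offsets converge to `∫ ‖F‖`
(`tendsto_riemann_sum_offset`, the spine's `tendsto_riemann_sum` with an offset `c_k → 0` threaded through); passing to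
the limit and summing over the valid strings gives `‖S₁ n F‖ ≤ #strings · (C κ⁴)ⁿ ∫ ‖F‖`.

References: J. Glimm, A. Jaffe, Quantum Physics (1987) §6.1; K. Osterwalder, R. Schrader, CMP 31 (1973) §2.
-/

set_option autoImplicit false

noncomputable section

open MeasureTheory Filter Topology Metric
open scoped BigOperators SchwartzMap
open Literature.MathematicalPhysics.QuantumFieldTheory hiding ZdEdge
open Literature.MathematicalPhysics.QuantumLattice
open Literature.MathematicalPhysics.AQFT
open Literature.Probability.LatticeModels (Site box mem_box)
open Summit.QuantumFields.YangMills.Cruxes.OSLegsFromFemtoAndGap.DlrCollarTransfer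
open Summit.QuantumFields.YangMills.Cruxes.OSLegsAtWeakCouplingC.Sketch
  (OffDiagDensity Separated sum_indicator_cell_eq integral_sum_indicator_cell norm_floor_sub_le measurableSet_cell)
open Summit.QuantumFields.YangMills.Theorems.OSLegsFromFemtoAndGap
  (exists_collar_radius mul_norm_le_norm_smul_siteToE norm_smul_siteToE_sub_le)

namespace Summit.QuantumFields.YangMills.Theorems.InfiniteVolume.E1

/-! ## Riemann sums with a vanishing offset -/

/-- **Riemann sums with a moving offset.**  If `a_k > 0`, `a_k → 0`, `a_k L_k → ∞` and the offsets `c_k → 0`, then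
`a_k^{4N} ∑_{x ∈ (box L_k)ᴺ} g(a_k x + c_k) → ∫ g` for a continuous compactly supported `g` (the spine's
`tendsto_riemann_sum` with the offset threaded through: the step function `y ↦ g(a ⌊y/a⌋ + c_k)` still converges
pointwise to `g`). [folklore] -/
theorem tendsto_riemann_sum_offset {N : ℕ} (g : (Fin N → EuclideanSpace ℝ (Fin 4)) → ℝ) (hg : Continuous g)
    (hgc : HasCompactSupport g) (a : ℕ → ℝ) (L : ℕ → ℕ) (c : ℕ → (Fin N → EuclideanSpace ℝ (Fin 4)))
    (ha : ∀ k, 0 < a k) (ha0 : Tendsto a atTop (𝓝 0)) (haL : Tendsto (fun k => a k * L k) atTop atTop)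
    (hc : Tendsto c atTop (𝓝 0)) :
    Tendsto (fun k => a k ^ (4 * N) * ∑ x ∈ Fintype.piFinset (fun _ : Fin N => box 4 (L k)),
      g ((fun i => a k • siteToE (x i)) + c k)) atTop (𝓝 (∫ y, g y)) := by
  classical
  obtain ⟨ρ, hρ0, hρ⟩ : ∃ ρ : ℝ, 0 ≤ ρ ∧ tsupport g ⊆ closedBall (0 : Fin N → EuclideanSpace ℝ (Fin 4)) ρ := by
    obtain ⟨ρ, hρ⟩ := hgc.isCompact.isBounded.subset_closedBall 0
    exact ⟨max ρ 0, le_max_right _ _, hρ.trans (closedBall_subset_closedBall (le_max_left _ _))⟩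
  obtain ⟨M, hM⟩ := hg.bounded_above_of_compact_support hgc
  obtain ⟨fl, hfl⟩ :
      ∃ fl : ℝ → (Fin N → EuclideanSpace ℝ (Fin 4)) → (Fin N → Site 4), ∀ b y i j, fl b y i j = ⌊y i j / b⌋ :=
    ⟨fun b y i j => ⌊y i j / b⌋, fun _ _ _ _ => rfl⟩
  have hc1 : ∀ᶠ k in atTop, ‖c k‖ ≤ 1 := by
    have := (tendsto_iff_norm_sub_tendsto_zero.1 hc).eventually (ge_mem_nhds one_pos)
    simpa using this
  -- pointwise convergence of `g (a_k ⌊y / a_k⌋ + c_k)` to `g y`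
  have h_lim : ∀ y : Fin N → EuclideanSpace ℝ (Fin 4),
      Tendsto (fun k => g ((fun i => a k • siteToE (fl (a k) y i)) + c k)) atTop (𝓝 (g y)) := by
    intro y
    refine (hg.tendsto y).comp ?_
    have h1 : Tendsto (fun k => (fun i => a k • siteToE (fl (a k) y i))) atTop (𝓝 y) := by
      rw [tendsto_iff_norm_sub_tendsto_zero]
      refine squeeze_zero (fun k => norm_nonneg _) (fun k => norm_floor_sub_le (ha k) y _ (hfl (a k) y)) ?_
      simpa using ha0.const_mul 2
    simpa using h1.add hc
  -- covering: eventually every lattice multi-site seen by `g (· + c_k)` lies in the box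
  have hcover : ∀ᶠ k in atTop, ∀ x : Fin N → Site 4, g ((fun i => a k • siteToE (x i)) + c k) ≠ 0 →
      x ∈ Fintype.piFinset (fun _ : Fin N => box 4 (L k)) := by
    filter_upwards [haL.eventually_ge_atTop (ρ + 1), hc1] with k hk hck x hx
    have hy : (fun i => a k • siteToE (x i)) + c k ∈ closedBall (0 : Fin N → EuclideanSpace ℝ (Fin 4)) ρ :=
      hρ (subset_tsupport _ (Function.mem_support.2 hx))
    rw [mem_closedBall, dist_zero_right] at hy
    have hy' : ‖(fun i => a k • siteToE (x i))‖ ≤ ρ + 1 := by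
      have := norm_le_norm_add_norm_sub' ((fun i => a k • siteToE (x i)) + c k) (c k)
      simp only [add_sub_cancel_right] at this
      calc ‖(fun i => a k • siteToE (x i))‖ ≤ ‖(fun i => a k • siteToE (x i)) + c k‖ + ‖c k‖ := by
            have h := norm_add_le ((fun i => a k • siteToE (x i)) + c k) (-c k)
            simpa using h
        _ ≤ ρ + 1 := add_le_add hy hck
    refine Fintype.mem_piFinset.2 fun i => mem_box.2 fun j => ?_
    have h1 : a k * ‖x i‖ ≤ ρ + 1 :=
      (mul_norm_le_norm_smul_siteToE (ha k).le (x i)).trans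
        ((norm_le_pi_norm (fun i => a k • siteToE (x i)) i).trans hy')
    have h2 : (‖x i j‖ : ℝ) ≤ ‖x i‖ := norm_le_pi_norm (x i) j
    rw [Int.norm_eq_abs] at h2
    have h3 : a k * |(x i j : ℝ)| ≤ a k * (L k : ℝ) := by
      have := mul_le_mul_of_nonneg_left h2 (ha k).le
      linarith
    have h4 := abs_le.1 (le_of_mul_le_mul_left h3 (ha k))
    exact ⟨by exact_mod_cast h4.1, by exact_mod_cast h4.2⟩
  -- the step functions, eventually
  have hstep : ∀ᶠ k in atTop, (fun y => g ((fun i => a k • siteToE (fl (a k) y i)) + c k)) = fun y =>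
      ∑ x ∈ Fintype.piFinset (fun _ : Fin N => box 4 (L k)),
        {z : Fin N → EuclideanSpace ℝ (Fin 4) | ∀ i j, a k * x i j ≤ z i j ∧ z i j < a k * x i j + a k}.indicator
          (fun _ => g ((fun i => a k • siteToE (x i)) + c k)) y := by
    filter_upwards [hcover] with k hk
    exact funext fun y =>
      (sum_indicator_cell_eq (ha k) (fun z => g (z + c k)) _ hk y (fl (a k) y) (hfl (a k) y)).symm
  -- dominated convergence
  have hDCT : Tendsto (fun k => ∫ y, g ((fun i => a k • siteToE (fl (a k) y i)) + c k)) atTop (𝓝 (∫ y, g y)) := by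
    refine tendsto_integral_filter_of_dominated_convergence
      (fun y => (closedBall (0 : Fin N → EuclideanSpace ℝ (Fin 4)) (ρ + 2)).indicator (fun _ => M) y) ?_ ?_ ?_ ?_
    · filter_upwards [hstep] with k hk
      rw [hk]
      refine Finset.aestronglyMeasurable_fun_sum _ fun x _ => ?_
      exact aestronglyMeasurable_const.indicator (measurableSet_cell (a k) x)
    · filter_upwards [ha0.eventually (ge_mem_nhds (by norm_num : (0 : ℝ) < 1 / 2)), hc1] with k hk hck
      refine Eventually.of_forall fun y => ?_
      by_cases hy : y ∈ closedBall (0 : Fin N → EuclideanSpace ℝ (Fin 4)) (ρ + 2)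
      · rw [Set.indicator_of_mem hy]
        exact hM _
      · rw [Set.indicator_of_notMem hy]
        have hzero : g ((fun i => a k • siteToE (fl (a k) y i)) + c k) = 0 := by
          by_contra hne
          have hz : (fun i => a k • siteToE (fl (a k) y i)) + c k ∈
              closedBall (0 : Fin N → EuclideanSpace ℝ (Fin 4)) ρ :=
            hρ (subset_tsupport _ (Function.mem_support.2 hne))
          rw [mem_closedBall, dist_zero_right] at hz
          have hd := norm_floor_sub_le (ha k) y _ (hfl (a k) y)
          refine hy ?_
          rw [mem_closedBall, dist_zero_right]
          calc ‖y‖ = ‖((fun i => a k • siteToE (fl (a k) y i)) + c k) -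
                (((fun i => a k • siteToE (fl (a k) y i)) - y) + c k)‖ := by congr 1; abel
            _ ≤ ‖(fun i => a k • siteToE (fl (a k) y i)) + c k‖ +
                ‖((fun i => a k • siteToE (fl (a k) y i)) - y) + c k‖ := norm_sub_le _ _
            _ ≤ ρ + (2 * a k + 1) := add_le_add hz ((norm_add_le _ _).trans (add_le_add hd hck))
            _ ≤ ρ + 2 := by linarith
        rw [hzero, norm_zero]
    · exact (integrable_indicator_iff measurableSet_closedBall).2
        (integrableOn_const (isCompact_closedBall _ _).measure_lt_top.ne)
    · exact Eventually.of_forall h_lim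
  refine hDCT.congr' ?_
  filter_upwards [hstep] with k hk
  rw [hk, integral_sum_indicator_cell (ha k)]

/-! ## Geometry of the lattice strings seen by a separated test function -/

/-- Some coordinate realises the sup norm of a site of `ℤ⁴`. [folklore] -/
theorem exists_coord_norm_le_abs (z : Site 4) : ∃ l : Fin 4, (‖z‖ : ℝ) ≤ |((z l : ℤ) : ℝ)| := by
  obtain ⟨l, -, hl⟩ := Finset.exists_max_image Finset.univ (fun l : Fin 4 => |((z l : ℤ) : ℝ)|) Finset.univ_nonempty
  refine ⟨l, (pi_norm_le_iff_of_nonneg (abs_nonneg _)).2 fun l' => ?_⟩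
  rw [Int.norm_eq_abs]
  exact hl l' (Finset.mem_univ _)

/-! ## The stub -/

variable {G : Type} [Group G] [TopologicalSpace G] [IsTopologicalGroup G] [CompactSpace G]
  [MeasurableSpace G] [BorelSpace G]

/-- **W2 — `OffDiagDensity S₁` from `MomentBounds6` along the DATA clause** (registered stub `stub_ivDensity` of the
skeleton of `IVEuclideanInvariance`, stmt-QuantumFields-19933): for `n ≥ 2`, `δ > 0` and a compactly supported `F` with
`tsupport F ⊆ Separated n δ`, `‖S₁ n F‖ ≤ #strings · (C κ⁴)ⁿ ∫ ‖F‖` with `κ = 48/δ + 2/ℓ₄ + 24` and the `MomentBounds6`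
constants `C, ℓ₄`; arities `0`, `1` by the conventions. [folklore] -/
theorem stub_ivDensity (r : LatticeRep G) (a : ℝ → ℝ) (β : ℕ → ℝ) (μ : ℕ → Measure (LGConfig 4 G))
    (S₁ : SchwingerFamily (EuclideanSpace ℝ (Fin 4)))
    (T : (n : ℕ) → (Fin n → Fin 4 × Fin 4) → (𝓢((Fin n → EuclideanSpace ℝ (Fin 4)), ℂ) →L[ℂ] ℂ))
    (hapos : ∀ b, 0 < a b) (ha0 : Tendsto a atTop (𝓝 0)) (hMB : MomentBounds6 G r a)
    (hβ : Tendsto β atTop atTop) (hμ : ∀ k, μ k ∈ oddTorusLimitPoints r (β k))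
    (h0 : ∀ F : 𝓢((Fin 0 → EuclideanSpace ℝ (Fin 4)), ℂ), S₁ 0 F = F default)
    (h1 : ∀ F : 𝓢((Fin 1 → EuclideanSpace ℝ (Fin 4)), ℂ), S₁ 1 F = 0)
    (hS : ∀ n : ℕ, 2 ≤ n → ∀ F : 𝓢((Fin n → EuclideanSpace ℝ (Fin 4)), ℂ),
      S₁ n F = ∑ q ∈ Fintype.piFinset (fun _ : Fin n => Finset.univ.filter fun p : Fin 4 × Fin 4 => p.1 < p.2), T n q F)
    (hT : ∀ n : ℕ, 2 ≤ n → ∀ q : Fin n → Fin 4 × Fin 4, (∀ i, (q i).1 < (q i).2) →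
      ∀ F : 𝓢((Fin n → EuclideanSpace ℝ (Fin 4)), ℂ), IsOffDiagonal F →
        Tendsto (fun k => ∑' x : Fin n → (Fin 4 → ℤ), ((stateMomentStr G r (μ k) n q x : ℝ) : ℂ) *
          F (fun l => a (β k) • siteToE (x l) + (a (β k) / 2) •
            (EuclideanSpace.single (q l).1 (1 : ℝ) + EuclideanSpace.single (q l).2 (1 : ℝ)))) atTop (𝓝 (T n q F))) :
    OffDiagDensity S₁ := by
  classical
  intro n δ hδ
  rcases n with _ | _ | n
  · refine ⟨1, fun F _ _ => ?_⟩
    have hint : ∫ x : Fin 0 → EuclideanSpace ℝ (Fin 4), ‖F x‖ = ‖F default‖ := by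
      rw [Measure.volume_pi_eq_dirac (default : Fin 0 → EuclideanSpace ℝ (Fin 4)), integral_dirac]
    rw [h0, one_mul, hint]
  · exact ⟨0, fun F _ _ => by rw [h1, norm_zero, zero_mul]⟩
  · -- arity `N = n + 2`
    obtain ⟨C, β₄, ℓ₄, hℓ, hC, H⟩ := (momentBounds6TL_iff G r a).1 (momentBounds6TL_of_momentBounds6 r hMB)
    set N : ℕ := n + 1 + 1 with hN
    have hN2 : 2 ≤ N := by omega
    set P : Finset (Fin N → Fin 4 × Fin 4) :=
      Fintype.piFinset (fun _ : Fin N => Finset.univ.filter fun p : Fin 4 × Fin 4 => p.1 < p.2) with hP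
    have hmemP : ∀ q, q ∈ P → ∀ i, (q i).1 < (q i).2 := fun q hq i => by
      rw [hP, Fintype.mem_piFinset] at hq
      exact (Finset.mem_filter.1 (hq i)).2
    set κ : ℝ := 48 / δ + 2 / ℓ₄ + 24 with hκ
    have hκ0 : 0 < κ := by positivity
    refine ⟨P.card * (C * κ ^ 4) ^ N, fun F hFc hFs => ?_⟩
    -- `F` is off-diagonal
    have hFoff : IsOffDiagonal F := by
      refine IsOffDiagonal.of_tsupport_subset fun y hy hcoin => ?_
      obtain ⟨i, j, hij, hyij⟩ := (mem_coincidenceLocus y).1 hcoin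
      have h : δ ≤ dist (y i) (y j) := hFs hy i j hij
      rw [hyij, dist_self] at h
      exact absurd h (not_le.2 hδ)
    -- a support radius
    obtain ⟨ρ, hρ0, hρ⟩ : ∃ ρ : ℝ, 0 ≤ ρ ∧ tsupport (F : (Fin N → EuclideanSpace ℝ (Fin 4)) → ℂ) ⊆
        closedBall (0 : Fin N → EuclideanSpace ℝ (Fin 4)) ρ := by
      obtain ⟨ρ, hρ⟩ := hFc.isCompact.isBounded.subset_closedBall 0
      exact ⟨max ρ 0, le_max_right _ _, hρ.trans (closedBall_subset_closedBall (le_max_left _ _))⟩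
    -- the lattice spacings and the centre offsets along the data
    set as : ℕ → ℝ := fun k => a (β k) with has
    have has_pos : ∀ k, 0 < as k := fun k => hapos _
    have has0 : Tendsto as atTop (𝓝 0) := ha0.comp hβ
    -- one bound per valid orientation string
    have hq : ∀ q ∈ P, ‖T N q F‖ ≤ (C * κ ^ 4) ^ N * ∫ y, ‖F y‖ := by
      intro q hqP
      have hqv := hmemP q hqP
      set c : ℕ → (Fin N → EuclideanSpace ℝ (Fin 4)) := fun k l =>
        (as k / 2) • (EuclideanSpace.single (q l).1 (1 : ℝ) + EuclideanSpace.single (q l).2 (1 : ℝ)) with hcdef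
      have hcl : ∀ k l, ‖c k l‖ ≤ as k := by
        intro k l
        simp only [hcdef]
        rw [norm_smul, Real.norm_of_nonneg (by have := has_pos k; positivity)]
        calc as k / 2 * ‖EuclideanSpace.single (q l).1 (1 : ℝ) + EuclideanSpace.single (q l).2 (1 : ℝ)‖
            ≤ as k / 2 * (‖EuclideanSpace.single (q l).1 (1 : ℝ)‖ + ‖EuclideanSpace.single (q l).2 (1 : ℝ)‖) :=
              mul_le_mul_of_nonneg_left (norm_add_le _ _) (by have := has_pos k; positivity)
          _ = as k := by
              rw [show EuclideanSpace.single (q l).1 (1 : ℝ) = PiLp.single 2 (q l).1 (1 : ℝ) from rfl,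
                show EuclideanSpace.single (q l).2 (1 : ℝ) = PiLp.single 2 (q l).2 (1 : ℝ) from rfl,
                PiLp.norm_single 2 (fun _ : Fin 4 => ℝ) (q l).1 (1 : ℝ),
                PiLp.norm_single 2 (fun _ : Fin 4 => ℝ) (q l).2 (1 : ℝ), norm_one]
              ring
      have hcn : ∀ k, ‖c k‖ ≤ as k := fun k => (pi_norm_le_iff_of_nonneg (has_pos k).le).2 (hcl k)
      have hc0 : Tendsto c atTop (𝓝 0) := by
        rw [tendsto_iff_norm_sub_tendsto_zero]
        refine squeeze_zero (fun k => norm_nonneg _) (fun k => by rw [sub_zero]; exact hcn k) has0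
      -- torus... no: box sides large enough to see the support, with `a_k L_k → ∞`
      set Ls : ℕ → ℕ := fun k => ⌈(ρ + 2) / (as k) ^ 2⌉₊ with hLs
      have hLsupp : ∀ k, as k ≤ 1 → (ρ + 1) / as k ≤ (Ls k : ℝ) := by
        intro k hk1
        refine le_trans ?_ (Nat.le_ceil _)
        have h0 := has_pos k
        rw [div_le_div_iff₀ h0 (by positivity)]
        have hsq : as k ^ 2 ≤ as k := by nlinarith
        calc (ρ + 1) * as k ^ 2 ≤ (ρ + 1) * as k := mul_le_mul_of_nonneg_left hsq (by linarith)
          _ ≤ (ρ + 2) * as k := by nlinarith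
      have haL : Tendsto (fun k => as k * Ls k) atTop atTop := by
        have h1 : Tendsto (fun k => (ρ + 2) / as k) atTop atTop := by
          have hinv : Tendsto (fun k => (as k)⁻¹) atTop atTop :=
            tendsto_inv_nhdsGT_zero.comp (tendsto_nhdsWithin_iff.2 ⟨has0, Eventually.of_forall has_pos⟩)
          simpa [div_eq_mul_inv] using hinv.const_mul_atTop (by positivity : (0 : ℝ) < ρ + 2)
        refine tendsto_atTop_mono (fun k => ?_) h1
        have := has_pos k
        calc (ρ + 2) / as k = as k * ((ρ + 2) / as k ^ 2) := by field_simp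
          _ ≤ as k * Ls k := mul_le_mul_of_nonneg_left (Nat.le_ceil _) this.le
      -- convergence of the series to `T N q F`, written along the data
      have hlim : Tendsto (fun k => ‖∑' x : Fin N → Site 4, ((stateMomentStr G r (μ k) N q x : ℝ) : ℂ) *
          F ((fun l => as k • siteToE (x l)) + c k)‖) atTop (𝓝 ‖T N q F‖) := by
        have := (hT N hN2 q hqv F hFoff).norm
        refine this.congr fun k => ?_
        rfl
      -- Riemann sums with the moving offsets
      have hRiem : Tendsto (fun k => as k ^ (4 * N) *
          ∑ x ∈ Fintype.piFinset (fun _ : Fin N => box 4 (Ls k)), ‖F ((fun i => as k • siteToE (x i)) + c k)‖)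
          atTop (𝓝 (∫ y, ‖F y‖)) :=
        tendsto_riemann_sum_offset (fun y => ‖F y‖) F.continuous.norm hFc.norm as Ls c has_pos has0 haL hc0
      -- eventual domination
      have hev : ∀ᶠ k in atTop, ‖∑' x : Fin N → Site 4, ((stateMomentStr G r (μ k) N q x : ℝ) : ℂ) *
          F ((fun l => as k • siteToE (x l)) + c k)‖ ≤
          (C * κ ^ 4) ^ N * (as k ^ (4 * N) *
            ∑ x ∈ Fintype.piFinset (fun _ : Fin N => box 4 (Ls k)), ‖F ((fun i => as k • siteToE (x i)) + c k)‖) := by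
        have hε : 0 < min (min 1 ℓ₄) (δ / 14) := lt_min (lt_min one_pos hℓ) (by positivity)
        filter_upwards [hβ.eventually_ge_atTop β₄, has0.eventually (gt_mem_nhds hε)] with k hkβ hka
        have hak : 0 < as k := has_pos k
        have ha1 : as k ≤ 1 := (hka.le.trans (min_le_left _ _)).trans (min_le_left _ _)
        have haℓ : as k ≤ ℓ₄ := (hka.le.trans (min_le_left _ _)).trans (min_le_right _ _)
        have haδ : as k * 14 ≤ δ := by
          have := hka.le.trans (min_le_right _ _)
          rwa [le_div_iff₀ (by norm_num : (0 : ℝ) < 14)] at this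
        -- collar radius for the lattice separation `δ' = (δ − 2a)/(2a) ≥ 6`
        set δ' : ℝ := (δ - 2 * as k) / (2 * as k) with hδ'
        have hδ'6 : 6 ≤ δ' := by
          rw [hδ', le_div_iff₀ (by positivity)]
          linarith
        have hL14 : 14 ≤ max 14 ⌈(as k)⁻¹ * (as k)⁻¹⌉₊ := le_max_left _ _
        have hLa : (as k)⁻¹ * (as k)⁻¹ ≤ (max 14 ⌈(as k)⁻¹ * (as k)⁻¹⌉₊ : ℕ) :=
          (Nat.le_ceil _).trans (by exact_mod_cast le_max_right _ _)
        obtain ⟨R, hR1, hRa, -, hRδ, hRinv⟩ := exists_collar_radius hδ'6 hℓ hak ha1 haℓ hL14 hLa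
        have hRpos : (0 : ℝ) < R := by exact_mod_cast hR1
        have hRinv' : (R : ℝ)⁻¹ ≤ as k * κ := by
          have h12 : 12 / δ' ≤ as k * (48 / δ) := by
            have hδ'pos : 0 < δ' := by linarith
            rw [div_le_iff₀ hδ'pos, hδ']
            have : as k * (48 / δ) * ((δ - 2 * as k) / (2 * as k)) = 24 * (δ - 2 * as k) / δ := by
              field_simp
              ring
            rw [this, le_div_iff₀ hδ]
            nlinarith
          calc (R : ℝ)⁻¹ ≤ 12 / δ' + as k * (2 / ℓ₄ + 24) := hRinv
            _ ≤ as k * (48 / δ) + as k * (2 / ℓ₄ + 24) := by linarith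
            _ = as k * κ := by rw [hκ]; ring
        -- the collar bound at the lattice strings seen by `F`
        have hW : ∀ x : Fin N → Site 4, F ((fun l => as k • siteToE (x l)) + c k) ≠ 0 →
            |stateMomentStr G r (μ k) N q x| ≤ (C * κ ^ 4) ^ N * as k ^ (4 * N) := by
          intro x hx
          have hy : (fun l => as k • siteToE (x l)) + c k ∈
              tsupport (F : (Fin N → EuclideanSpace ℝ (Fin 4)) → ℂ) :=
            subset_tsupport _ (Function.mem_support.2 hx)
          -- lattice sup-separation `≥ δ'`
          have hsepx : ∀ i j : Fin N, i ≠ j → δ' ≤ ‖x i - x j‖ := by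
            intro i j hij
            have hd : δ ≤ dist (((fun l => as k • siteToE (x l)) + c k) i)
                (((fun l => as k • siteToE (x l)) + c k) j) := hFs hy i j hij
            rw [dist_eq_norm] at hd
            simp only [Pi.add_apply] at hd
            have h2 := norm_smul_siteToE_sub_le hak.le (x i) (x j)
            have h3 : ‖as k • siteToE (x i) + c k i - (as k • siteToE (x j) + c k j)‖ ≤
                ‖as k • siteToE (x i) - as k • siteToE (x j)‖ + (‖c k i‖ + ‖c k j‖) := by
              calc _ = ‖(as k • siteToE (x i) - as k • siteToE (x j)) + (c k i - c k j)‖ := by congr 1; abel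
                _ ≤ ‖as k • siteToE (x i) - as k • siteToE (x j)‖ + ‖c k i - c k j‖ := norm_add_le _ _
                _ ≤ _ := add_le_add le_rfl (norm_sub_le _ _)
            have h4 : δ ≤ 2 * as k * ‖x i - x j‖ + 2 * as k := by linarith [hcl k i, hcl k j]
            rw [hδ', div_le_iff₀ (by positivity)]
            linarith
          have hsep : ∀ i j : Fin N, i ≠ j → ∃ l : Fin 4, (2 * (R : ℤ) + 4) ≤ |x i l - x j l| := by
            intro i j hij
            obtain ⟨l, hl⟩ := exists_coord_norm_le_abs (x i - x j)
            refine ⟨l, ?_⟩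
            have h1 : (2 * (R : ℝ) + 4) ≤ |(((x i - x j) l : ℤ) : ℝ)| := (hRδ.trans (hsepx i j hij)).trans hl
            have h2 : (((x i - x j) l : ℤ) : ℝ) = ((x i l - x j l : ℤ) : ℝ) := by simp [Pi.sub_apply]
            rw [h2, ← Int.cast_abs] at h1
            exact_mod_cast h1
          have hRa' : (R : ℝ) * a (β k) ≤ ℓ₄ := hRa
          have h1 := H (β k) hkβ (μ k) (hμ k) N q x R hqv hR1 hRa' hsep
          have h2 : C / (R : ℝ) ^ 4 ≤ C * κ ^ 4 * as k ^ 4 := by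
            have h3 : ((R : ℝ)⁻¹) ^ 4 ≤ (as k * κ) ^ 4 := pow_le_pow_left₀ (inv_nonneg.2 hRpos.le) hRinv' 4
            calc C / (R : ℝ) ^ 4 = C * ((R : ℝ)⁻¹) ^ 4 := by rw [div_eq_mul_inv, inv_pow]
              _ ≤ C * (as k * κ) ^ 4 := mul_le_mul_of_nonneg_left h3 hC
              _ = C * κ ^ 4 * as k ^ 4 := by ring
          calc |stateMomentStr G r (μ k) N q x| ≤ (C / (R : ℝ) ^ 4) ^ N := h1
            _ ≤ (C * κ ^ 4 * as k ^ 4) ^ N := pow_le_pow_left₀ (div_nonneg hC (pow_nonneg hRpos.le 4)) h2 N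
            _ = (C * κ ^ 4) ^ N * as k ^ (4 * N) := by rw [mul_pow, pow_mul]
        -- the series is a finite sum over the box
        have hbox : ∀ x : Fin N → Site 4, F ((fun l => as k • siteToE (x l)) + c k) ≠ 0 →
            x ∈ Fintype.piFinset (fun _ : Fin N => box 4 (Ls k)) := by
          intro x hx
          have hy : (fun l => as k • siteToE (x l)) + c k ∈ closedBall (0 : Fin N → EuclideanSpace ℝ (Fin 4)) ρ :=
            hρ (subset_tsupport _ (Function.mem_support.2 hx))
          rw [mem_closedBall, dist_zero_right] at hy
          have hy' : ‖(fun l => as k • siteToE (x l))‖ ≤ ρ + 1 := by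
            have h := norm_add_le ((fun l => as k • siteToE (x l)) + c k) (-c k)
            simp only [add_neg_cancel_right, norm_neg] at h
            exact h.trans (add_le_add hy ((hcn k).trans ha1))
          refine Fintype.mem_piFinset.2 fun i => mem_box.2 fun j => ?_
          have e1 : as k * ‖x i‖ ≤ ρ + 1 :=
            (mul_norm_le_norm_smul_siteToE hak.le (x i)).trans
              ((norm_le_pi_norm (fun l => as k • siteToE (x l)) i).trans hy')
          have e2 : (‖x i j‖ : ℝ) ≤ ‖x i‖ := norm_le_pi_norm (x i) j
          rw [Int.norm_eq_abs] at e2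
          have e3 : |(x i j : ℝ)| ≤ (Ls k : ℝ) := by
            have e4 : |(x i j : ℝ)| ≤ (ρ + 1) / as k := by
              rw [le_div_iff₀ hak]; nlinarith
            exact e4.trans (hLsupp k ha1)
          have e5 := abs_le.1 e3
          exact ⟨by exact_mod_cast e5.1, by exact_mod_cast e5.2⟩
        rw [tsum_eq_sum (s := Fintype.piFinset (fun _ : Fin N => box 4 (Ls k)))
          (fun x hx => by
            by_cases hF0 : F ((fun l => as k • siteToE (x l)) + c k) = 0
            · rw [hF0, mul_zero]
            · exact absurd (hbox x hF0) hx)]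
        refine (norm_sum_le _ _).trans ?_
        calc ∑ x ∈ Fintype.piFinset (fun _ : Fin N => box 4 (Ls k)),
              ‖((stateMomentStr G r (μ k) N q x : ℝ) : ℂ) * F ((fun l => as k • siteToE (x l)) + c k)‖
            ≤ ∑ x ∈ Fintype.piFinset (fun _ : Fin N => box 4 (Ls k)),
              (C * κ ^ 4) ^ N * as k ^ (4 * N) * ‖F ((fun l => as k • siteToE (x l)) + c k)‖ := by
              refine Finset.sum_le_sum fun x _ => ?_
              rw [norm_mul, Complex.norm_real, Real.norm_eq_abs]
              by_cases hx : F ((fun l => as k • siteToE (x l)) + c k) = 0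
              · simp [hx]
              · exact mul_le_mul_of_nonneg_right (hW x hx) (norm_nonneg _)
          _ = (C * κ ^ 4) ^ N * (as k ^ (4 * N) *
              ∑ x ∈ Fintype.piFinset (fun _ : Fin N => box 4 (Ls k)), ‖F ((fun i => as k • siteToE (x i)) + c k)‖) := by
              rw [Finset.mul_sum, Finset.mul_sum]
              exact Finset.sum_congr rfl fun x _ => by ring
      exact le_of_tendsto_of_tendsto hlim (hRiem.const_mul _) hev
    -- sum over the valid strings
    rw [hS N hN2 F]
    calc ‖∑ q ∈ P, T N q F‖ ≤ ∑ q ∈ P, ‖T N q F‖ := norm_sum_le _ _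
      _ ≤ ∑ q ∈ P, (C * κ ^ 4) ^ N * ∫ y, ‖F y‖ := Finset.sum_le_sum hq
      _ = P.card * (C * κ ^ 4) ^ N * ∫ y, ‖F y‖ := by rw [Finset.sum_const, nsmul_eq_mul, mul_assoc]

end Summit.QuantumFields.YangMills.Theorems.InfiniteVolume.E1

end
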